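import Summits.CriticalPhenomena.PercolationContinuityZ3.Theorems.PercNearOneGluingNoHeavyLowerTailCubicThreePointGluingJoinCells
import Summits.CriticalPhenomena.PercolationContinuityZ3.Theorems.PercNearOneGluingNoHeavyLowerTailCubicThreePointGluingPendantCells
import Summits.CriticalPhenomena.PercolationContinuityZ3.Theorems.PercNearOneGluingNoHeavyLowerTailCubicThreePointGluingMeasure
import HarnessLib

/-!
# `NoHeavyLowerTail` (stmt-CriticalPhenomena-4575) — decoupling across a vertex separator, part 4:
# the class `TSP` of terminal-series-parallel graphs; Sahi's `E₃ ≥ 0` on the pairwise separations (SHK3⁺) and the sharp row `Hmax3` hold on it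

Support file (prover prim-sahi-p2, SAHI cell P2 "restricted C₃ via percolation structure"; `--supports stmt-CriticalPhenomena-4575`).
ONE inductive definition (`TSP D K a b c`) packaging the graph moves of part 3 (`…GluingJoinCells`/`…GluingPendantCells`: `splaw_chord`, `splaw_join`,
`splaw_pendant`, `splaw_swap12/13`), and its consequences via the K3-semigroup theorem (`…CubicThreePointSeriesParallel`, prim-gen-kcluster);
no named facts, no sorries.

THE CLASS (`D` = random edges, `K` = forced edges, terminals `a, b, c`; all finite edge sets in `Sym2 V`):
* `chord`   — any system none of whose edges contains `c` (`a, b ≠ c`): an ARBITRARY two-terminal `a–b` network ("blob chord");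
* `join`    — the union of two systems on disjoint random edge sets whose edges meet only in `{a, b, c}` (parallel composition at the terminals);
* `pendant` — the union of an ARBITRARY network avoiding `b, c` with a system on `(h, b, c)` avoiding `a`, the two meeting only in the cut
              vertex `h` (an `a–h` "blob arm" hung at `h`; `a ≠ b, c`);
* `swap₁₂`, `swap₁₃` — relabelling of the terminals.
It contains every three-terminal graph built from two-terminal networks by series–parallel operations AT THE TERMINALS (triangles and stars
of blobs, `K₄`, `K_{2,3}`, hubs in parallel, blob rings, stars of stars, …); the first graph outside it is `K_{2,3}` plus the hub–hub edge
(prim-gen-kcluster KCLUSTER-gen9, prim-ineq-gen-2 HMAX-SPLIT §5).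

THEOREMS (weights `p ∈ [0,1]` arbitrary):
* `TSP.splaw` — the law `(PrW D p (evQ K a b c), …, PrW D p (evT K a b c))` of a `TSP` system is an `SPLaw` (induction over the decomposition);
* hence `TSP.sharp` (`AG ≥ 0 ∧ max(Ha,Hb) ≥ 0`: Gladkov's inequality and the SHARP DICHOTOMY `P(abc)² ≥ P(ab)P(ac)P(bc) ∨ P(a|b|c)² ≥ ∏ P(i∤rest)`),
  `TSP.Ha_nonneg_of_dense`, `TSP.Hb_nonneg_of_sparse`, `TSP.Hqt_nonneg`, `TSP.Xi_nonneg` (AG⁺) and **`TSP.shk3_nonneg`**: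
  `0 ≤ F = (σ+t)(qt − e₂) − e₃` = Richards–Sahi `E₃ ≥ 0` for `{a≁b}, {a≁c}, {b≁c}` (`prodBernoulli_sahiE3_pairSep_eq`) — the `|A| = 3`
  group-separation instance of Sahi's conjecture C₃ that the route's one-cut engine consumes, unconditionally on this class of GRAPHS
  (previously a theorem about abstract series–parallel LAWS only); `TSP.shk3W_nonneg` — the same as `0 ≤ shk3W D p K a b c`, i.e. the conclusion
  of prove-2's `shk3_of_stepHyp` (`…CubicThreePointInduction`) without the Bernstein-step hypothesis, on the class.
* `TSP.sahiE3_pairSep_nonneg` — the same in the Literature vocabulary: `0 ≤ sahiE3 (prodBernoulli w) (openConn a b)ᶜ (openConn a c)ᶜ (openConn b c)ᶜ`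
  for weights `w` supported on `D` with `TSP D ∅ a b c` (part 5's bridge `…CubicThreePointGluingMeasure`).
Memo: run/shared/lean/prim/prim-sahi/prim-sahi-p2/PROOF-E3.md.
[cite: Gladkov2024StrongFKG, Cor. 4.2 (the quadratic form AG)]; [cite: GladkovZimin2024HK, §4 (one-coordinate / block decomposition)]
-/

noncomputable section

namespace Summit.CriticalPhenomena.PercolationContinuityZ3.Theorems

open Finset SimpleGraph MeasureTheory Literature.Probability.Percolation Literature.Probability.Percolation.DecisionTree
open Literature.Probability.LatticeModels CubicThreePointStep CubicThreePointTerminal CubicThreePointJoin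

variable {V : Type*} [DecidableEq V]

namespace TerminalGluing

/-! ### The class of terminal-series-parallel percolation systems -/

/-- **Terminal-series-parallel three-terminal percolation systems** (`D` random edges, `K` forced edges, terminals `a, b, c`): generated from
two-terminal networks avoiding the third terminal (`chord`) by parallel composition at the terminals (`join`), hanging an arbitrary
two-terminal arm at a cut vertex (`pendant`), and relabelling (`swap₁₂`, `swap₁₃`). [folklore] -/
inductive TSP : Finset (Sym2 V) → Finset (Sym2 V) → V → V → V → Prop
  | chord {D K : Finset (Sym2 V)} {a b c : V} (hc : ∀ e ∈ D ∪ K, c ∉ e) (hac : a ≠ c) (hbc : b ≠ c) : TSP D K a b c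
  | swap₁₂ {D K : Finset (Sym2 V)} {a b c : V} (h : TSP D K a b c) : TSP D K b a c
  | swap₁₃ {D K : Finset (Sym2 V)} {a b c : V} (h : TSP D K a b c) : TSP D K c b a
  | join {D₁ D₂ K₁ K₂ : Finset (Sym2 V)} {a b c : V} (h₁ : TSP D₁ K₁ a b c) (h₂ : TSP D₂ K₂ a b c) (hD : Disjoint D₁ D₂)
      (hsep : ∀ v : V, ∀ e₁ ∈ D₁ ∪ K₁, ∀ e₂ ∈ D₂ ∪ K₂, v ∈ e₁ → v ∈ e₂ → (v = a ∨ v = b ∨ v = c)) :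
      TSP (D₁ ∪ D₂) (K₁ ∪ K₂) a b c
  | pendant {D₁ D₂ K₁ K₂ : Finset (Sym2 V)} {a b c h : V} (h₂ : TSP D₂ K₂ h b c) (hD : Disjoint D₁ D₂)
      (hsep : ∀ v : V, ∀ e₁ ∈ D₁ ∪ K₁, ∀ e₂ ∈ D₂ ∪ K₂, v ∈ e₁ → v ∈ e₂ → v = h)
      (ha : ∀ e ∈ D₂ ∪ K₂, a ∉ e) (hb : ∀ e ∈ D₁ ∪ K₁, b ∉ e) (hc : ∀ e ∈ D₁ ∪ K₁, c ∉ e) (hab : a ≠ b) (hac : a ≠ c) :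
      TSP (D₁ ∪ D₂) (K₁ ∪ K₂) a b c

section Main

variable {D K : Finset (Sym2 V)} {a b c : V} {p : Sym2 V → ℝ} (hp0 : ∀ i, 0 ≤ p i) (hp1 : ∀ i, p i ≤ 1)
include hp0 hp1

/-- **The three-point law of a terminal-series-parallel system is a series–parallel law.** [folklore] -/
theorem TSP.splaw (h : TSP D K a b c) :
    SPLaw (PrW D p (evQ K a b c)) (PrW D p (evU₁ K a b c)) (PrW D p (evU₂ K a b c)) (PrW D p (evU₃ K a b c))
      (PrW D p (evT K a b c)) := by
  induction h with
  | @chord D K a b c hc hac hbc => exact splaw_chord D hp0 hp1 hc hac hbc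
  | @swap₁₂ D K a b c _ ih => exact splaw_swap12 D ih
  | @swap₁₃ D K a b c _ ih => exact splaw_swap13 D ih
  | join _ _ hD hsep ih₁ ih₂ => exact splaw_join p hD hsep ih₁ ih₂
  | pendant _ hD hsep ha hb hc hab hac ih => exact splaw_pendant p hD hp0 hp1 hsep ha hb hc hab hac ih

/-- **Gladkov's `AG ≥ 0` and the SHARP DICHOTOMY `max(Ha, Hb) ≥ 0`** (`P(abc)² ≥ P(ab)P(ac)P(bc)` or `P(a|b|c)² ≥ ∏ P(i ∤ rest)`) for every
terminal-series-parallel system — the K3-semigroup theorem applied to an actual graph decomposition. [folklore] -/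
theorem TSP.sharp (h : TSP D K a b c) :
    0 ≤ AG (PrW D p (evQ K a b c)) (PrW D p (evU₁ K a b c)) (PrW D p (evU₂ K a b c)) (PrW D p (evU₃ K a b c))
        (PrW D p (evT K a b c)) ∧
      0 ≤ max (Ha (PrW D p (evQ K a b c)) (PrW D p (evU₁ K a b c)) (PrW D p (evU₂ K a b c)) (PrW D p (evU₃ K a b c))
              (PrW D p (evT K a b c)))
            (Hb (PrW D p (evQ K a b c)) (PrW D p (evU₁ K a b c)) (PrW D p (evU₂ K a b c)) (PrW D p (evU₃ K a b c))
              (PrW D p (evT K a b c))) :=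
  (h.splaw hp0 hp1).sharp

/-- Dense regime: `P(a|b|c) ≤ P(abc) ⇒ P(abc)² ≥ P(ab)·P(ac)·P(bc)` (`Ha ≥ 0`) on the class. [folklore] -/
theorem TSP.Ha_nonneg_of_dense (h : TSP D K a b c) (hqt : PrW D p (evQ K a b c) ≤ PrW D p (evT K a b c)) :
    0 ≤ Ha (PrW D p (evQ K a b c)) (PrW D p (evU₁ K a b c)) (PrW D p (evU₂ K a b c)) (PrW D p (evU₃ K a b c))
      (PrW D p (evT K a b c)) :=
  (h.splaw hp0 hp1).Ha_nonneg_of_dense hqt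

/-- Sparse regime: `P(abc) ≤ P(a|b|c) ⇒ P(a|b|c)² ≥ ∏ᵢ P(i ∤ rest)` (`Hb ≥ 0`) on the class. [folklore] -/
theorem TSP.Hb_nonneg_of_sparse (h : TSP D K a b c) (htq : PrW D p (evT K a b c) ≤ PrW D p (evQ K a b c)) :
    0 ≤ Hb (PrW D p (evQ K a b c)) (PrW D p (evU₁ K a b c)) (PrW D p (evU₂ K a b c)) (PrW D p (evU₃ K a b c))
      (PrW D p (evT K a b c)) :=
  (h.splaw hp0 hp1).Hb_nonneg_of_sparse htq

/-- `H_{q+t} = (q+t)·AG − e₃ ≥ 0` on the class. [folklore] -/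
theorem TSP.Hqt_nonneg (h : TSP D K a b c) :
    0 ≤ Hqt (PrW D p (evQ K a b c)) (PrW D p (evU₁ K a b c)) (PrW D p (evU₂ K a b c)) (PrW D p (evU₃ K a b c))
      (PrW D p (evT K a b c)) :=
  (h.splaw hp0 hp1).Hqt_nonneg

/-- AG⁺ (`Ξ = σ·AG − e₃ ≥ 0`, i.e. `P(a|b|c)P(abc) ≥ e₂(u) + e₃(u)`) on the class. [folklore] -/
theorem TSP.Xi_nonneg (h : TSP D K a b c) :
    0 ≤ Xi (PrW D p (evQ K a b c)) (PrW D p (evU₁ K a b c)) (PrW D p (evU₂ K a b c)) (PrW D p (evU₃ K a b c))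
      (PrW D p (evT K a b c)) :=
  (h.splaw hp0 hp1).Xi_nonneg

/-- **SHK3⁺ = Richards–Sahi `E₃ ≥ 0` on the three pairwise separations, for every terminal-series-parallel graph**:
`0 ≤ F(q,u₁,u₂,u₃,t) = (σ + t)(q t − e₂(u)) − e₃(u)` — the `|A| = 3` group-separation instance of Sahi's C₃ (`prodBernoulli_sahiE3_pairSep_eq`),
unconditionally, on this class. [folklore] -/
theorem TSP.shk3_nonneg (h : TSP D K a b c) :
    0 ≤ CubicThreePointStep.F (PrW D p (evQ K a b c)) (PrW D p (evU₁ K a b c)) (PrW D p (evU₂ K a b c))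
      (PrW D p (evU₃ K a b c)) (PrW D p (evT K a b c)) :=
  (h.splaw hp0 hp1).F_nonneg

/-- The same in the notation of `…CubicThreePointInduction`: `0 ≤ shk3W D p K a b c` (the conclusion of prove-2's `shk3_of_stepHyp`,
here WITHOUT the Bernstein-step hypothesis, on the class). [folklore] -/
theorem TSP.shk3W_nonneg (h : TSP D K a b c) : 0 ≤ shk3W D p K a b c :=
  h.shk3_nonneg hp0 hp1

end Main

/-- **The C₃ instance for terminal-series-parallel graphs, in the Literature vocabulary.**  For Bernoulli bond percolation `prodBernoulli w` on a
finite vertex type whose weights vanish off a finite edge set `D` with `TSP D ∅ a b c` (no forced edges):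
`0 ≤ E₃({a≁b},{a≁c},{b≁c}) = sahiE3 (prodBernoulli w) (openConn a b)ᶜ (openConn a c)ᶜ (openConn b c)ᶜ` — Richards–Sahi positivity of the third
functional on the three pairwise separations (Kahn's Conjecture 5 / Sahi C₃, this instance), via part 5's bridge `sahiE3_pairSep_nonneg_of_splaw`.
[cite: LiebSahi2021, eq. (2.1) and Conj. 1.1 (the functional and the conjecture; here a theorem for this class)] -/
theorem TSP.sahiE3_pairSep_nonneg [Fintype V] (w : Sym2 V → unitInterval) {D : Finset (Sym2 V)} {a b c : V}
    (hw : ∀ e, e ∉ D → w e = 0) (h : TSP D ∅ a b c) :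
    0 ≤ sahiE3 (prodBernoulli w) (openConn a b)ᶜ (openConn a c)ᶜ (openConn b c)ᶜ :=
  sahiE3_pairSep_nonneg_of_splaw w a b c D hw
    (h.splaw (fun e => unitInterval.nonneg (w e)) (fun e => unitInterval.le_one (w e)))

end TerminalGluing

end Summit.CriticalPhenomena.PercolationContinuityZ3.Theorems
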